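import Mathlib.Analysis.SpecialFunctions.Complex.Circle
import Mathlib.Algebra.Field.GeomSum
import Mathlib.Data.Fintype.BigOperators
import Mathlib.Algebra.BigOperators.Field
import HarnessLib

/-!
# Kitaev's eigenvalue measurement, I: character sums and repeated-test statistics

Family `PQC` (trunk `CryptoQuantFine`); groundwork for the quantum half of Shor's order-finding
theorem (`Literature.Computability.Cryptography.Shor1997_orderFinding_isQSolvable`, `ShorProofs.lean`) along Kitaev's route
(A. Yu. Kitaev 1995, §3: eigenvalue measurement by Hadamard tests of the controlled powers
`U^{2^j}`, which over the tree's exact Clifford+T gate set replaces Shor's transform `A_q`).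
This file is the elementary finite analysis behind Kitaev's Remark 8, Lemma 8 and the estimate
before Lemma 9, in a form that avoids eigenvector decompositions:

* `sum_range_exp_two_pi_mul`, `sum_pi_exp_two_pi_mul` — orthogonality of the characters of
  `ℤ/r` and of `(ℤ/r)^K`;
* `parseval_fibers` — **Parseval regrouping**: if `κ` identifies exactly the arguments whose
  exponent vectors `A_t` agree modulo `r`, then `∑_ω |∑_{κ c = ω} φ(c)|²` is the average over
  `s ∈ (ℤ/r)^K` of `|∑_c φ(c) e^{2πi⟨s, A(c)⟩/r}|²` (Kitaev 1995, §4: for the state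
  `|a⟩ = q^{-1/2} ∑_h |ψ_h⟩` the outcome distribution is `P(h) = q⁻¹ ∑_{h'} P(h', h)` — a
  uniformly random eigenvalue index, then the conditional law);
* `sum_pi_bool_prod`, `sum_trialExponent_eq`, `sum_prod_mul_exp_eq_prod` — factorisation of
  the amplitude sum over independent control bits (Kitaev 1995, §3, Lemma 8 (3): measurement
  operators with disjoint additional registers multiply);
* `norm_sq_testAmplitude` — the single Hadamard-test probabilities
  `(1 + (-1)^γ cos θ)/2` and, with an `S³ = S†` gate on the control, `(1 + (-1)^γ sin θ)/2`
  (Kitaev 1995, §3, Remark 8: `P(φ, 0) = (1 + cos 2πφ)/2`; "if we substitute `iU` for `U`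
  then `cos(2πφ)` will change to `-sin(2πφ)`");
* `sum_prodWeight`, `expect_coord`, `expect_coord_pair`, `expect_sq_dev`, `chebyshev_block` —
  product distributions on `{0,1}^J` (independent tests): marginals, the variance
  `∑ p_j (1 - p_j)` of the number of `1`s in a block of tests, and **Chebyshev's inequality**
  for that number (Kitaev 1995, §3, before Lemma 9: "since `z_1, …, z_s` behave as
  independent random variables, `y/s` is most likely close to `P(φ, 1)`"; Kitaev states a
  Chernoff bound `2 exp(-c(δ) s)`, the second-moment bound `|B|/(4a²)` suffices for
  polynomial-size circuits).

## References

* A. Yu. Kitaev, *Quantum measurements and the Abelian Stabilizer Problem*,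
  arXiv:quant-ph/9511026 (1995), §3 (Remark 8, Lemma 8, the discussion before Lemma 9; pp. 13–14
  of the arXiv version) and §4 (p. 15: `P(h) = q⁻¹ ∑_{h'} P(h', h)`).
* P. W. Shor, *Polynomial-time algorithms for prime factorization and discrete logarithms on a
  quantum computer*, SIAM J. Comput. 26 (1997) 1484–1509, §5 (the theorem served).

## Mathlib

`Complex.exp_int_mul_two_pi_mul_I`, `Complex.exp_eq_one_iff`, `geom_sum_eq`,
`Finset.prod_univ_sum`, `Fintype.piFinset_univ`, `Finset.sum_fiberwise`, `Complex.mul_conj`,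
`Complex.normSq_eq_norm_sq`, `Real.sin_sq_add_cos_sq`. All statements are [folklore] finite
sums; the cites locate their role in Kitaev's argument.
-/



noncomputable section

namespace Literature.Computability.Cryptography

namespace Kitaev1995

open Complex Finset Real

/-! ### Orthogonality of characters of `ℤ/r` -/

/-- `∑_{s<r} e^{2πi s m/r} = r` if `r ∣ m` and `0` otherwise (`0 < r`). [folklore] -/
theorem sum_range_exp_two_pi_mul (r : ℕ) (hr : 0 < r) (m : ℤ) :
    ∑ s ∈ range r, cexp (2 * π * I * ((s : ℂ) * m / r)) =
      if (r : ℤ) ∣ m then (r : ℂ) else 0 := by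
  have hr0 : (r : ℂ) ≠ 0 := by exact_mod_cast hr.ne'
  split_ifs with hdvd
  · obtain ⟨t, rfl⟩ := hdvd
    have : ∀ s ∈ range r, cexp (2 * π * I * ((s : ℂ) * ((r * t : ℤ) : ℂ) / r)) = 1 := by
      intro s _
      have h : 2 * π * I * ((s : ℂ) * ((r * t : ℤ) : ℂ) / r) = ((s * t : ℤ) : ℂ) * (2 * π * I) := by
        push_cast; field_simp
      rw [h]
      exact Complex.exp_int_mul_two_pi_mul_I _
    rw [sum_congr rfl this, sum_const, card_range, nsmul_eq_mul, mul_one]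
  · set ζ : ℂ := cexp (2 * π * I * ((m : ℂ) / r)) with hζ
    have hterm : ∀ s ∈ range r, cexp (2 * π * I * ((s : ℂ) * m / r)) = ζ ^ s := by
      intro s _
      rw [hζ, ← Complex.exp_nat_mul]
      congr 1; ring
    rw [sum_congr rfl hterm]
    have hζ1 : ζ ≠ 1 := by
      intro h
      rw [hζ, Complex.exp_eq_one_iff] at h
      obtain ⟨n, hn⟩ := h
      have h2 : (2 * π * I : ℂ) ≠ 0 := by
        simp [Real.pi_ne_zero, Complex.I_ne_zero]
      have : (m : ℂ) / r = n := by
        have := congrArg (· / (2 * π * I)) hn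
        simpa [mul_div_assoc, mul_comm, h2] using this
      rw [div_eq_iff hr0] at this
      apply hdvd
      refine ⟨n, ?_⟩
      have : (m : ℂ) = ((n * r : ℤ) : ℂ) := by rw [this]; push_cast; ring
      exact_mod_cast (by rw [mul_comm] at this; exact_mod_cast this : (m : ℂ) = ((r * n : ℤ) : ℂ))
    have hζr : ζ ^ r = 1 := by
      rw [hζ, ← Complex.exp_nat_mul]
      have : (r : ℂ) * (2 * π * I * ((m : ℂ) / r)) = (m : ℂ) * (2 * π * I) := by
        field_simp
      rw [this]
      exact Complex.exp_int_mul_two_pi_mul_I m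
    rw [geom_sum_eq hζ1, hζr, sub_self, zero_div]


/-- `‖z‖²` as a complex number is `z · conj z`. [folklore] -/
theorem ofReal_norm_sq (z : ℂ) : ((‖z‖ ^ 2 : ℝ) : ℂ) = z * (starRingEnd ℂ) z := by
  rw [Complex.mul_conj, Complex.normSq_eq_norm_sq, Complex.ofReal_pow]

/-- `‖∑ f‖² = ∑ᵢ ∑ⱼ fᵢ conj(fⱼ)` (as complex numbers). [folklore] -/
theorem ofReal_norm_sq_sum {ι : Type*} (s : Finset ι) (f : ι → ℂ) :
    ((‖∑ i ∈ s, f i‖ ^ 2 : ℝ) : ℂ) = ∑ i ∈ s, ∑ j ∈ s, f i * (starRingEnd ℂ) (f j) := by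
  rw [ofReal_norm_sq, map_sum, sum_mul]
  refine sum_congr rfl fun i _ => ?_
  rw [mul_sum]

/-- The conjugate of `e^{2πi x}` for real `x` is `e^{-2πi x}`. [folklore] -/
theorem conj_exp_two_pi_mul_I (x : ℝ) :
    (starRingEnd ℂ) (cexp (2 * π * I * x)) = cexp (2 * π * I * (-x)) := by
  rw [← Complex.exp_conj]
  congr 1
  simp only [map_mul, map_ofNat, Complex.conj_ofReal, Complex.conj_I]
  ring

/-- Orthogonality of the characters of `(ℤ/r)^K`:
`∑_{s ∈ (ℤ/r)^K} e^{2πi (∑_t s_t d_t)/r}` is `r^K` if `r ∣ d_t` for all `t` and `0` otherwise.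
[folklore] -/
theorem sum_pi_exp_two_pi_mul {T : Type*} [Fintype T] [DecidableEq T] {r : ℕ} (hr : 0 < r)
    (d : T → ℤ) :
    ∑ s : T → Fin r, cexp (2 * π * I * ((∑ t, ((s t : ℕ) : ℂ) * d t) / r)) =
      if ∀ t, (r : ℤ) ∣ d t then (r : ℂ) ^ Fintype.card T else 0 := by
  -- the summand is a product of characters of `ℤ/r`
  have hterm : ∀ s : T → Fin r, cexp (2 * π * I * ((∑ t, ((s t : ℕ) : ℂ) * d t) / r)) =
      ∏ t, cexp (2 * π * I * (((s t : ℕ) : ℂ) * d t / r)) := by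
    intro s
    rw [← Complex.exp_sum, sum_div, mul_sum]
  rw [sum_congr rfl fun s _ => hterm s]
  -- sum of products = product of sums
  have hswap : ∑ s : T → Fin r, ∏ t, cexp (2 * π * I * (((s t : ℕ) : ℂ) * d t / r)) =
      ∏ t : T, ∑ u : Fin r, cexp (2 * π * I * (((u : ℕ) : ℂ) * d t / r)) := by
    rw [Finset.prod_univ_sum, Fintype.piFinset_univ]
  rw [hswap]
  have hfac : ∀ t : T, ∑ u : Fin r, cexp (2 * π * I * (((u : ℕ) : ℂ) * d t / r)) =
      if (r : ℤ) ∣ d t then (r : ℂ) else 0 := by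
    intro t
    rw [← sum_range_exp_two_pi_mul r hr (d t), ← Fin.sum_univ_eq_sum_range]
  rw [prod_congr rfl fun t _ => hfac t]
  by_cases hall : ∀ t, (r : ℤ) ∣ d t
  · rw [if_pos hall, prod_congr rfl fun t _ => if_pos (hall t), prod_const, card_univ]
  · rw [if_neg hall]
    obtain ⟨t, ht⟩ := not_forall.mp hall
    exact prod_eq_zero (mem_univ t) (if_neg ht)

/-- **Parseval regrouping over `(ℤ/r)^K`.** If the map `κ` identifies exactly those `c, c'`
whose exponent vectors agree modulo `r` (`A_t c ≡ A_t c' (mod r)` for all `t`), then the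
total squared mass of `φ` summed fibrewise over `κ` equals the average over the characters
`s ∈ (ℤ/r)^K` of `|∑_c φ(c) e^{2πi ⟨s, A(c)⟩/r}|²` (Kitaev 1995, §4: the measured register
holds `g(a)`, and `P(h) = q⁻¹ ∑_{h'} P(h', h)` by expanding `|a⟩` in the Fourier basis
`|ψ_h⟩`; here in the elementary form that avoids eigenvectors). [cite: Kitaev1995, §4 (Fourier basis, P(h) = q^{-1} sum_{h'} P(h',h))] -/
theorem parseval_fibers {C Ω T : Type*} [Fintype C] [Fintype Ω] [DecidableEq Ω] [Fintype T]
    [DecidableEq T] {r : ℕ} (hr : 0 < r) (A : T → C → ℤ) (κ : C → Ω)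
    (hκ : ∀ c c', κ c = κ c' ↔ ∀ t, (r : ℤ) ∣ A t c - A t c') (φ : C → ℂ) :
    ∑ ω, ‖∑ c ∈ univ.filter (fun c => κ c = ω), φ c‖ ^ 2 =
      (1 / (r : ℝ) ^ Fintype.card T) * ∑ s : T → Fin r,
        ‖∑ c, φ c * cexp (2 * π * I * ((∑ t, ((s t : ℕ) : ℂ) * A t c) / r))‖ ^ 2 := by
  classical
  have hr0 : (r : ℂ) ≠ 0 := by exact_mod_cast hr.ne'
  apply Complex.ofReal_injective
  rw [Complex.ofReal_sum, Complex.ofReal_mul, Complex.ofReal_sum]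
  -- left-hand side: `∑_c ∑_{c'} [κ c' = κ c] φ c conj(φ c')`
  have hL : (∑ ω, ((‖∑ c ∈ univ.filter (fun c => κ c = ω), φ c‖ ^ 2 : ℝ) : ℂ)) =
      ∑ c, ∑ c', if κ c' = κ c then φ c * (starRingEnd ℂ) (φ c') else 0 := by
    simp_rw [ofReal_norm_sq_sum]
    rw [show (∑ ω, ∑ c ∈ univ.filter (fun c => κ c = ω), ∑ c' ∈ univ.filter (fun c => κ c = ω),
          φ c * (starRingEnd ℂ) (φ c')) =
        ∑ ω, ∑ c ∈ univ.filter (fun c => κ c = ω), ∑ c' ∈ univ.filter (fun c' => κ c' = κ c),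
          φ c * (starRingEnd ℂ) (φ c') from
      sum_congr rfl fun ω _ => sum_congr rfl fun c hc => by rw [(mem_filter.1 hc).2]]
    rw [sum_fiberwise univ κ fun c => ∑ c' ∈ univ.filter (fun c' => κ c' = κ c),
      φ c * (starRingEnd ℂ) (φ c')]
    refine sum_congr rfl fun c _ => ?_
    rw [sum_filter]
  -- right-hand side
  have hR : (((1 / (r : ℝ) ^ Fintype.card T : ℝ) : ℂ) * ∑ s : T → Fin r,
      ((‖∑ c, φ c * cexp (2 * π * I * ((∑ t, ((s t : ℕ) : ℂ) * A t c) / r))‖ ^ 2 : ℝ) : ℂ)) =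
      ∑ c, ∑ c', if κ c' = κ c then φ c * (starRingEnd ℂ) (φ c') else 0 := by
    simp_rw [ofReal_norm_sq_sum]
    rw [sum_comm, mul_sum]
    refine sum_congr rfl fun c _ => ?_
    rw [sum_comm, mul_sum]
    refine sum_congr rfl fun c' _ => ?_
    -- the phases combine into a character evaluated at the difference
    have hph : ∀ s : T → Fin r,
        φ c * cexp (2 * π * I * ((∑ t, ((s t : ℕ) : ℂ) * A t c) / r)) *
          (starRingEnd ℂ) (φ c' * cexp (2 * π * I * ((∑ t, ((s t : ℕ) : ℂ) * A t c') / r))) =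
        φ c * (starRingEnd ℂ) (φ c') *
          cexp (2 * π * I * ((∑ t, ((s t : ℕ) : ℂ) * ((A t c - A t c' : ℤ) : ℂ)) / r)) := by
      intro s
      have h1 : (starRingEnd ℂ) (cexp (2 * π * I * ((∑ t, ((s t : ℕ) : ℂ) * A t c') / r))) =
          cexp (2 * π * I * (-((∑ t, ((s t : ℕ) : ℂ) * A t c') / r))) := by
        have := conj_exp_two_pi_mul_I ((∑ t, ((s t : ℕ) : ℝ) * A t c') / r)
        push_cast at this ⊢
        exact this
      rw [map_mul, h1, mul_mul_mul_comm, ← Complex.exp_add]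
      congr 2
      have hsum : (∑ t, ((s t : ℕ) : ℂ) * ((A t c - A t c' : ℤ) : ℂ)) =
          (∑ t, ((s t : ℕ) : ℂ) * A t c) - ∑ t, ((s t : ℕ) : ℂ) * A t c' := by
        rw [← sum_sub_distrib]
        refine sum_congr rfl fun t _ => ?_
        push_cast
        ring
      rw [hsum]
      ring
    rw [sum_congr rfl fun s _ => hph s, ← mul_sum, sum_pi_exp_two_pi_mul hr]
    split_ifs with h1 h2 h2
    · push_cast
      field_simp
    · exact absurd ((hκ c c').2 h1) (Ne.symm h2)
    · exact absurd ((hκ c' c).1 h2) (fun h => h1 fun t => by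
        have := h t; rw [← neg_sub] at this ⊢; exact (dvd_neg.2 (h t)) |> fun h' => by
          simpa using h')
    · simp
  exact hL.trans hR.symm


/-! ### Factorisation over independent control bits -/

/-- A sum over bit vectors of a product of one-bit factors is the product of the one-bit
sums. [folklore] -/
theorem sum_pi_bool_prod {J R : Type*} [Fintype J] [DecidableEq J] [CommSemiring R]
    (u : J → Bool → R) :
    ∑ c : J → Bool, ∏ j, u j (c j) = ∏ j, (u j false + u j true) := by
  rw [← Fintype.piFinset_univ, ← Finset.prod_univ_sum]
  refine prod_congr rfl fun j _ => ?_
  rw [Fintype.sum_bool, add_comm]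

/-- The exponent carried by the control bits of trial `t`: `A_t(c) = ∑_{j : τ j = t} c_j 2^{e_j}`
(Kitaev 1995, §3, eq. before Lemma 10: the operator `U^{[0,r]} |a, ξ⟩ = |a⟩ ⊗ U^a |ξ⟩` with
`a` read off the control bits in binary; here several tests may share an exponent).
[cite: Kitaev1995, §3 (Lemma 10)] -/
theorem sum_trialExponent_eq {J T : Type*} [Fintype J] [Fintype T] [DecidableEq T]
    (τ : J → T) (e : J → ℕ) (s : T → ℂ) (c : J → Bool) :
    (∑ t, s t * ∑ j ∈ univ.filter (fun j => τ j = t), (((c j).toNat * 2 ^ e j : ℕ) : ℂ)) =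
      ∑ j, s (τ j) * (((c j).toNat * 2 ^ e j : ℕ) : ℂ) := by
  simp_rw [mul_sum]
  rw [show (∑ t, ∑ j ∈ univ.filter (fun j => τ j = t), s t * (((c j).toNat * 2 ^ e j : ℕ) : ℂ)) =
      ∑ t, ∑ j ∈ univ.filter (fun j => τ j = t), s (τ j) * (((c j).toNat * 2 ^ e j : ℕ) : ℂ) from
    sum_congr rfl fun t _ => sum_congr rfl fun j hj => by rw [(mem_filter.1 hj).2]]
  exact sum_fiberwise univ τ _

/-- **Factorisation of the Kitaev amplitude.** With one-bit factors `χ_j` and the phase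
`e^{2πi ⟨s, A(c)⟩/r}`, `A_t(c) = ∑_{τ j = t} c_j 2^{e_j}`, the sum over all control strings
factorises: `∑_c (∏_j χ_j(c_j)) e^{2πi⟨s,A(c)⟩/r} = ∏_j (χ_j(0) + χ_j(1) e^{2πi s_{τ j} 2^{e_j}/r})`
(Kitaev 1995, §3, Lemma 8(3): measurements with disjoint additional registers multiply).
[cite: Kitaev1995, §3 Lemma 8] -/
theorem sum_prod_mul_exp_eq_prod {J T : Type*} [Fintype J] [DecidableEq J] [Fintype T]
    [DecidableEq T] (r : ℕ) (τ : J → T) (e : J → ℕ) (χ : J → Bool → ℂ) (s : T → ℂ) :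
    ∑ c : J → Bool, (∏ j, χ j (c j)) *
        cexp (2 * π * I * ((∑ t, s t * ∑ j ∈ univ.filter (fun j => τ j = t),
          (((c j).toNat * 2 ^ e j : ℕ) : ℂ)) / r)) =
      ∏ j, (χ j false + χ j true * cexp (2 * π * I * (s (τ j) * 2 ^ e j / r))) := by
  have hterm : ∀ c : J → Bool, (∏ j, χ j (c j)) *
      cexp (2 * π * I * ((∑ t, s t * ∑ j ∈ univ.filter (fun j => τ j = t),
        (((c j).toNat * 2 ^ e j : ℕ) : ℂ)) / r)) =
      ∏ j, χ j (c j) * cexp (2 * π * I * (s (τ j) * (((c j).toNat * 2 ^ e j : ℕ) : ℂ) / r)) := by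
    intro c
    rw [sum_trialExponent_eq, sum_div, mul_sum, Complex.exp_sum, ← prod_mul_distrib]
  rw [sum_congr rfl fun c _ => hterm c, sum_pi_bool_prod fun j b =>
    χ j b * cexp (2 * π * I * (s (τ j) * ((b.toNat * 2 ^ e j : ℕ) : ℂ) / r))]
  refine prod_congr rfl fun j _ => ?_
  simp only [Bool.toNat_false, Bool.toNat_true, zero_mul, one_mul, Nat.cast_zero,
    mul_zero, zero_div, Complex.exp_zero, mul_one]
  push_cast
  ring_nf

/-! ### The single-test probabilities -/

/-- **Kitaev's Hadamard-test probabilities** (Kitaev 1995, §3, Remark 8, eq. for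
`P_{Ξ(U)}(φ, 0) = (1 + cos 2πφ)/2`, and "if we substitute `iU` for `U` then `cos` changes to
`-sin`"): the squared modulus of the one-bit amplitude `(1 + (-1)^γ κ_σ e^{iθ})/2`, with
`κ = 1` for a cosine test and `κ = -i` for a sine test (an `S³ = S†` gate before the final
Hadamard), is `(1 + (-1)^γ cos θ)/2` resp. `(1 + (-1)^γ sin θ)/2`.
[cite: Kitaev1995, §3 Remark 8] -/
theorem norm_sq_testAmplitude (γ σ : Bool) (θ : ℝ) :
    ‖(1 + (if γ then (-1 : ℂ) else 1) * (if σ then -I else 1) * cexp (θ * I)) / 2‖ ^ 2 =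
      (1 + (if γ then (-1 : ℝ) else 1) * (if σ then Real.sin θ else Real.cos θ)) / 2 := by
  have hcs := Real.sin_sq_add_cos_sq θ
  rw [← Complex.normSq_eq_norm_sq, Complex.normSq_apply]
  cases γ <;> cases σ <;>
    simp [Complex.exp_ofReal_mul_I_re, Complex.exp_ofReal_mul_I_im] <;> nlinarith [hcs]

/-! ### Product distributions: marginals, variance, Chebyshev -/

section ProductWeights

variable {J : Type*} [Fintype J] [DecidableEq J]

/-- A sum over bit vectors of a product of one-bit factors (real version of
`sum_pi_bool_prod`). [folklore] -/
theorem sum_pi_bool_prod_real (v : J → Bool → ℝ) :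
    ∑ γ : J → Bool, ∏ j, v j (γ j) = ∏ j, (v j false + v j true) := by
  rw [← Fintype.piFinset_univ, ← Finset.prod_univ_sum]
  refine prod_congr rfl fun j _ => ?_
  rw [Fintype.sum_bool, add_comm]

/-- Product weights are a probability distribution. [folklore] -/
theorem sum_prodWeight (w : J → Bool → ℝ) (hw1 : ∀ j, w j false + w j true = 1) :
    ∑ γ : J → Bool, ∏ j, w j (γ j) = 1 := by
  rw [sum_pi_bool_prod_real]
  exact prod_eq_one fun j _ => hw1 j

/-- **Expectation of a function of one coordinate** under product weights: the marginal of
bit `j` is `w j`. [folklore] -/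
theorem expect_coord (w : J → Bool → ℝ) (hw1 : ∀ j, w j false + w j true = 1) (j : J)
    (g : Bool → ℝ) :
    ∑ γ : J → Bool, (∏ i, w i (γ i)) * g (γ j) = w j false * g false + w j true * g true := by
  classical
  have hterm : ∀ γ : J → Bool, (∏ i, w i (γ i)) * g (γ j) =
      ∏ i, (w i (γ i) * if i = j then g (γ i) else 1) := by
    intro γ
    rw [prod_mul_distrib, Fintype.prod_ite_eq']
  have hprod := sum_pi_bool_prod_real fun i b => w i b * if i = j then g b else 1
  beta_reduce at hprod
  rw [sum_congr rfl fun γ _ => hterm γ, hprod]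
  rw [show (∏ i, (w i false * (if i = j then g false else 1) + w i true * (if i = j then g true else 1)))
      = ∏ i, (if i = j then w j false * g false + w j true * g true else 1) from
    prod_congr rfl fun i _ => by
      split_ifs with h
      · subst h; rfl
      · rw [mul_one, mul_one, hw1]]
  exact Fintype.prod_ite_eq' j _

/-- **Expectation of a product of functions of two distinct coordinates** under product
weights: independence of distinct bits. [folklore] -/
theorem expect_coord_pair (w : J → Bool → ℝ) (hw1 : ∀ j, w j false + w j true = 1)
    {j j' : J} (hjj : j ≠ j') (g h : Bool → ℝ) :
    ∑ γ : J → Bool, (∏ i, w i (γ i)) * (g (γ j) * h (γ j')) =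
      (w j false * g false + w j true * g true) * (w j' false * h false + w j' true * h true) := by
  classical
  have hterm : ∀ γ : J → Bool, (∏ i, w i (γ i)) * (g (γ j) * h (γ j')) =
      ∏ i, (w i (γ i) * ((if i = j then g (γ i) else 1) * if i = j' then h (γ i) else 1)) := by
    intro γ
    rw [prod_mul_distrib, prod_mul_distrib, Fintype.prod_ite_eq', Fintype.prod_ite_eq']
  have hprod := sum_pi_bool_prod_real fun i b =>
    w i b * ((if i = j then g b else 1) * if i = j' then h b else 1)
  beta_reduce at hprod
  rw [sum_congr rfl fun γ _ => hterm γ, hprod]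
  rw [show (∏ i, (w i false * ((if i = j then g false else 1) * if i = j' then h false else 1) +
        w i true * ((if i = j then g true else 1) * if i = j' then h true else 1)))
      = ∏ i, ((if i = j then w j false * g false + w j true * g true else 1) *
          (if i = j' then w j' false * h false + w j' true * h true else 1)) from
    prod_congr rfl fun i _ => by
      by_cases h1 : i = j
      · subst h1
        simp only [if_true, if_neg hjj, mul_one]
      · by_cases h2 : i = j'
        · subst h2
          simp only [if_true, if_neg h1, one_mul]
        · simp only [if_neg h1, if_neg h2, mul_one, hw1]]
  rw [prod_mul_distrib, Fintype.prod_ite_eq', Fintype.prod_ite_eq']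

omit [Fintype J] [DecidableEq J] in
/-- The number of `1`s of `γ` in the block `B`, as a real number, is `∑_{j ∈ B} [γ j]`.
[folklore] -/
theorem card_filter_eq_sum_ite (B : Finset J) (γ : J → Bool) :
    ((B.filter fun j => γ j = true).card : ℝ) = ∑ j ∈ B, if γ j = true then (1 : ℝ) else 0 := by
  rw [Finset.card_filter]
  push_cast
  rfl

/-- **Variance of the number of `1`s in a block** under product weights:
`E[(#{j ∈ B : γ j} - ∑_{j∈B} p_j)²] = ∑_{j∈B} p_j (1 - p_j)` (`p_j = w j 1`). [folklore] -/
theorem expect_sq_dev (w : J → Bool → ℝ) (hw1 : ∀ j, w j false + w j true = 1)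
    (B : Finset J) :
    ∑ γ : J → Bool, (∏ i, w i (γ i)) *
        (((B.filter fun j => γ j = true).card : ℝ) - ∑ j ∈ B, w j true) ^ 2 =
      ∑ j ∈ B, w j true * w j false := by
  classical
  -- centred indicators
  set Y : J → Bool → ℝ := fun j b => (if b = true then (1 : ℝ) else 0) - w j true with hY
  have hdev : ∀ γ : J → Bool,
      ((B.filter fun j => γ j = true).card : ℝ) - ∑ j ∈ B, w j true = ∑ j ∈ B, Y j (γ j) := by
    intro γ
    rw [card_filter_eq_sum_ite, ← sum_sub_distrib]
  have hmeanY : ∀ j, w j false * Y j false + w j true * Y j true = 0 := by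
    intro j
    have := hw1 j
    simp only [hY, Bool.false_eq_true, if_false, if_true, zero_sub]
    have hf : w j false = 1 - w j true := by linarith
    rw [hf]; ring
  have hvarY : ∀ j, w j false * (Y j false * Y j false) + w j true * (Y j true * Y j true) =
      w j true * w j false := by
    intro j
    have := hw1 j
    simp only [hY, Bool.false_eq_true, if_false, if_true, zero_sub]
    have hf : w j false = 1 - w j true := by linarith
    rw [hf]; ring
  simp_rw [hdev, sq, sum_mul_sum, mul_sum]
  rw [sum_comm]
  refine sum_congr rfl fun j hj => ?_
  rw [sum_comm]
  rw [show (∑ j' ∈ B, ∑ γ : J → Bool, (∏ i, w i (γ i)) * (Y j (γ j) * Y j' (γ j'))) =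
      ∑ j' ∈ B, if j' = j then w j true * w j false else 0 from
    sum_congr rfl fun j' _ => by
      split_ifs with h
      · subst h
        rw [expect_coord w hw1 j' fun b => Y j' b * Y j' b, hvarY]
      · rw [expect_coord_pair w hw1 (Ne.symm h), hmeanY, zero_mul]]
  rw [sum_ite_eq', if_pos hj]

/-- **Chebyshev's inequality for a block of independent tests**: under product weights
(nonnegative, normalised), the outcomes `γ` whose number of `1`s in the block `B` deviates
from its mean `∑_{j∈B} p_j` by at least `a > 0` have total weight `≤ |B| / (4a²)`
(Kitaev 1995, §3, the estimate before Lemma 9, in Chebyshev form). [cite: Kitaev1995, §3 (Lemma 9)] -/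
theorem chebyshev_block (w : J → Bool → ℝ) (hw0 : ∀ j b, 0 ≤ w j b)
    (hw1 : ∀ j, w j false + w j true = 1) (B : Finset J) {a : ℝ} (ha : 0 < a) :
    ∑ γ ∈ univ.filter (fun γ : J → Bool =>
        a ≤ |((B.filter fun j => γ j = true).card : ℝ) - ∑ j ∈ B, w j true|),
      (∏ i, w i (γ i)) ≤ (B.card : ℝ) / (4 * a ^ 2) := by
  classical
  set dev : (J → Bool) → ℝ := fun γ =>
    ((B.filter fun j => γ j = true).card : ℝ) - ∑ j ∈ B, w j true with hdev
  have hWnn : ∀ γ : J → Bool, 0 ≤ ∏ i, w i (γ i) := fun γ => prod_nonneg fun i _ => hw0 i _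
  -- `a² · W(D) ≤ E[dev²]`
  have h1 : a ^ 2 * ∑ γ ∈ univ.filter (fun γ => a ≤ |dev γ|), (∏ i, w i (γ i)) ≤
      ∑ γ, (∏ i, w i (γ i)) * dev γ ^ 2 := by
    rw [mul_sum]
    calc ∑ γ ∈ univ.filter (fun γ => a ≤ |dev γ|), a ^ 2 * ∏ i, w i (γ i)
        ≤ ∑ γ ∈ univ.filter (fun γ => a ≤ |dev γ|), (∏ i, w i (γ i)) * dev γ ^ 2 := by
          refine sum_le_sum fun γ hγ => ?_
          have hγ' : a ≤ |dev γ| := (mem_filter.1 hγ).2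
          have : a ^ 2 ≤ dev γ ^ 2 := by
            rw [← sq_abs (dev γ)]
            exact pow_le_pow_left₀ ha.le hγ' 2
          rw [mul_comm]
          exact mul_le_mul_of_nonneg_left this (hWnn γ)
      _ ≤ ∑ γ, (∏ i, w i (γ i)) * dev γ ^ 2 :=
          sum_le_sum_of_subset_of_nonneg (filter_subset _ _) fun γ _ _ =>
            mul_nonneg (hWnn γ) (sq_nonneg _)
  -- `E[dev²] = ∑ p(1-p) ≤ |B|/4`
  have h2 : ∑ γ, (∏ i, w i (γ i)) * dev γ ^ 2 ≤ (B.card : ℝ) / 4 := by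
    rw [hdev, expect_sq_dev w hw1 B]
    calc ∑ j ∈ B, w j true * w j false ≤ ∑ _j ∈ B, (1 / 4 : ℝ) := by
          refine sum_le_sum fun j _ => ?_
          have := hw1 j
          nlinarith [sq_nonneg (w j true - w j false)]
      _ = (B.card : ℝ) / 4 := by rw [sum_const, nsmul_eq_mul]; ring
  rw [le_div_iff₀ (by positivity)]
  calc (∑ γ ∈ univ.filter (fun γ => a ≤ |dev γ|), ∏ i, w i (γ i)) * (4 * a ^ 2)
      = 4 * (a ^ 2 * ∑ γ ∈ univ.filter (fun γ => a ≤ |dev γ|), ∏ i, w i (γ i)) := by ring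
    _ ≤ 4 * ((B.card : ℝ) / 4) := by nlinarith [h1, h2]
    _ = (B.card : ℝ) := by ring

end ProductWeights

end Kitaev1995

end Literature.Computability.Cryptography

end
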